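import Summits.HubbardSuperconductivity.HubbardSuperconductivity.Theorems.AnisotropyChordStiffnessBondSquare
import Summits.HubbardSuperconductivity.HubbardSuperconductivity.Theorems.AnisotropyChordBipartiteClassFunction
import Literature.Probability.LatticeModels.GaussianDomination
import Literature.Probability.LatticeModels.TorusBipartite
import Mathlib.Algebra.QuadraticDiscriminant

/-!
# Route `AnisotropyChord` / H0 rotor rung: THE DIAMAGNETIC GRID BOUND (S5)(c) of THEOREM TWIST-IR, PROVED for
# `L ≥ 3` (theory seat memo ROTOR-THEORY-8 §107 L3(c), §109; typed `DiamagneticGridBound`, which is FALSE at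
# `L ∈ {1, 2}` — the corrected statement carries `3 ≤ L`)

For the hard-core boson / XXZ torus `(ℤ/L)²`, `L ≥ 3`, a Perron sector amplitude `ψ` (sector `M`, energy `E₀`),
any grid momentum `k`, any `η ∈ ℂ²` and any `φ` in the sector:

  `2 |⟨φ, (Σᵢ ηᵢ Jⁱ_k) ψ⟩|² ≤ (Σᵢ |ηᵢ|² ⟨ψ, (−Tᵢ) ψ⟩) · Re⟨φ, (H − E₀) φ⟩`

(`diamagneticGridBound_of_three_le`), i.e. `m₋₁(J_{η,k}) ≤ ½ Σᵢ |ηᵢ|² ⟨−Tᵢ⟩` — the upper grid bound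
`K^{tot}(k) ≼ diag(tᵢ/2)` of memo §107 L3(c).  PROOF (exact, replaces the Kato–Simon + expansion recipe of
§109 and is valid for complex bond fields directly): write `φ = u·ψ` (`ψ > 0` on the sector: Perron–Frobenius,
`xxz_sector_perron_pos`); the ground-state transform (`xxz_groundStateTransform`) gives
`Re⟨φ,(H−E₀)φ⟩ = Σ_{edges} ¼Σ_{flip} ψψ'|u − u'|² ≥ Σ_{directed bonds (x, x+eᵢ)} (…)` (the map
`(x,i) ↦ {x, x+eᵢ}` is injective for `L ≥ 3`); the per-bond square `bond_square_nonneg` with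
`A_{(x,i)} = w ηᵢ φ_k(x)` sums to `0 ≤ q − 2Re(−i w ℓ) + ½|w|² D` for every `w ∈ ℂ` (`ℓ = ⟨φ, J_{η,k}ψ⟩`,
`D = Σᵢ|ηᵢ|²⟨−Tᵢ⟩`), and `w = i t conj ℓ` + the discriminant give `2|ℓ|² ≤ D q`.
Why `L ≥ 3`: at `L = 2` the directed bonds double-cover the edges (the typed inequality fails by a factor up to 2,
ED kit j298210), at `L = 1` the «bond current» `j_{xx} = Sᶻ_x` is not a current.
-/

set_option linter.dupNamespace false

noncomputable section

open Matrix Complex Finset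
open scoped ComplexConjugate
open Literature.MathematicalPhysics.QuantumLattice hiding torusPhase torusNorm
open Literature.Probability.LatticeModels
open Summit.HubbardSuperconductivity.HubbardSuperconductivity.Theorems.AnisotropyChord.InsertionEntropy
  (torusPhase norm_torusPhase IsPerronSectorGroundAmplitude)

namespace Summit.HubbardSuperconductivity.HubbardSuperconductivity.Theorems.AnisotropyChord.Stiffness

variable {L : ℕ} [NeZero L]

/-! ## Directed bonds of the torus, `L ≥ 3` -/

omit [NeZero L] in
/-- `x + eᵢ ≠ x` on the torus with `L ≥ 2`. [folklore] -/
theorem add_single_ne_self (hL : 2 ≤ L) (x : TorusSite 2 L) (i : Fin 2) : x + Pi.single i 1 ≠ x := by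
  intro h
  exact torus_single_ne_zero hL i (by simpa using h)

/-- `s(x, x+eᵢ)` is an edge of the torus graph (`L ≥ 2`). [folklore] -/
theorem bond_mem_edgeFinset (hL : 2 ≤ L) (x : TorusSite 2 L) (i : Fin 2) :
    s(x, x + Pi.single i 1) ∈ (torusGraph 2 L).edgeFinset := by
  rw [SimpleGraph.mem_edgeFinset, SimpleGraph.mem_edgeSet]
  exact torusGraph_adj_add_single hL x i

omit [NeZero L] in
/-- For `L ≥ 3`, `eᵢ + eⱼ ≠ 0` on `(ℤ/L)²`. [folklore] -/
theorem single_add_single_ne_zero (hL : 3 ≤ L) (i j : Fin 2) :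
    (Pi.single i 1 : TorusSite 2 L) + Pi.single j 1 ≠ 0 := by
  intro h
  have hi := congr_fun h i
  simp only [Pi.add_apply, Pi.single_eq_same, Pi.zero_apply] at hi
  by_cases hij : j = i
  · subst hij
    rw [Pi.single_eq_same] at hi
    have h2 : ((2 : ℕ) : ZMod L) = 0 := by
      have : (1 : ZMod L) + 1 = ((2 : ℕ) : ZMod L) := by push_cast; ring
      rw [← this]; exact hi
    rw [ZMod.natCast_eq_zero_iff] at h2
    have := Nat.le_of_dvd (by norm_num) h2
    omega
  · rw [Pi.single_eq_of_ne (Ne.symm hij) , add_zero] at hi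
    haveI : Fact (1 < L) := ⟨by omega⟩
    exact one_ne_zero hi

omit [NeZero L] in
/-- **The directed bonds `(x,i) ↦ {x, x+eᵢ}` are distinct edges for `L ≥ 3`.** [folklore] -/
theorem bond_injective (hL : 3 ≤ L) :
    Function.Injective fun p : TorusSite 2 L × Fin 2 => (s(p.1, p.1 + Pi.single p.2 1) : Sym2 (TorusSite 2 L)) := by
  rintro ⟨x, i⟩ ⟨x', j⟩ h
  have h' := Sym2.eq_iff.mp h
  rcases h' with h'' | h''
  · obtain ⟨h1, h2⟩ := h''
    have hij : (Pi.single i 1 : TorusSite 2 L) = Pi.single j 1 := by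
      rw [h1] at h2; exact add_left_cancel h2
    have : i = j := by
      by_contra hne
      have hval := congr_fun hij i
      rw [Pi.single_eq_same, Pi.single_eq_of_ne' (Ne.symm hne)] at hval
      haveI : Fact (1 < L) := ⟨by omega⟩
      exact one_ne_zero hval
    rw [Prod.mk.injEq]
    exact ⟨h1, this⟩
  · -- `x = x' + e_j` and `x + e_i = x'` force `e_i + e_j = 0`
    obtain ⟨h1, h2⟩ := h''
    exfalso
    apply single_add_single_ne_zero (L := L) hL i j
    have key : x' + (Pi.single i 1 + Pi.single j 1) = x' + 0 := by
      rw [add_zero, add_comm (Pi.single i 1), ← add_assoc, ← h1, h2]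
    exact add_left_cancel key

/-- **Bond sum ≤ edge sum:** for a non-negative edge function `g`,
`Σ_{x,i} g{x, x+eᵢ} ≤ Σ_{e ∈ E} g e` (`L ≥ 3`). [folklore] -/
theorem sum_bond_le_sum_edge (hL : 3 ≤ L) (g : Sym2 (TorusSite 2 L) → ℝ)
    (hg : ∀ e ∈ (torusGraph 2 L).edgeFinset, 0 ≤ g e) :
    ∑ p : TorusSite 2 L × Fin 2, g s(p.1, p.1 + Pi.single p.2 1)
      ≤ ∑ e ∈ (torusGraph 2 L).edgeFinset, g e := by
  classical
  rw [← Finset.sum_image (f := g)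
    (s := (Finset.univ : Finset (TorusSite 2 L × Fin 2)))
    (g := fun p : TorusSite 2 L × Fin 2 => (s(p.1, p.1 + Pi.single p.2 1) : Sym2 (TorusSite 2 L)))
    (fun p _ q _ h => bond_injective hL h)]
  refine Finset.sum_le_sum_of_subset_of_nonneg ?_ (fun e he _ => hg e he)
  intro e he
  rw [Finset.mem_image] at he
  obtain ⟨p, -, rfl⟩ := he
  exact bond_mem_edgeFinset (by omega) p.1 p.2

/-! ## Perron positivity on the sector and the `u`-representation -/

/-- **A Perron sector amplitude is strictly positive wherever a sector vector lives** (Perron–Frobenius on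
the connected configuration graph of the sector, `xxz_sector_perron_pos`, and uniqueness). [folklore] -/
theorem perronAmplitude_pos_of_ne_zero (Δ M : ℝ) (a : TensorIndex (TorusSite 2 L) 2 → ℝ)
    (ha : IsPerronSectorGroundAmplitude L Δ M a) (φ : TensorIndex (TorusSite 2 L) 2 → ℂ)
    (hφ : φ ∈ spinZSector (Λ := TorusSite 2 L) 1 M) (σ : TensorIndex (TorusSite 2 L) 2) (hσ : φ σ ≠ 0) :
    0 < a σ := by
  set ψ : TensorIndex (TorusSite 2 L) 2 → ℂ := fun τ => (a τ : ℂ) with hψ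
  have hψ0 : ψ ≠ 0 := by
    intro h0
    have : ∑ τ, a τ ^ 2 = 0 := Finset.sum_eq_zero fun τ _ => by
      have := congrFun h0 τ
      simp only [hψ, Pi.zero_apply, Complex.ofReal_eq_zero] at this
      rw [this]; ring
    rw [ha.unit] at this
    exact one_ne_zero this
  obtain ⟨W, hWatt, hMW⟩ := exists_weight_of_mem_spinZSector ha.sector hψ0
  obtain ⟨ψ₀, h0sec, h0ne, h0nn, h0pos, h0off, h0eig, h0uniq⟩ :=
    xxz_sector_perron_pos (torusGraph 2 L) (torusGraph_connected_of_proj 2 L) Δ W hWatt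
  have hsec := ha.sector
  have heig := ha.eigen
  rw [hMW] at hsec heig hφ
  obtain ⟨c, hc⟩ := h0uniq ψ hsec heig
  -- `φ σ ≠ 0` puts `σ` in the weight sector, where `ψ₀ σ > 0`
  have hσW : (∑ z, (σ z : ℕ)) = W := by
    by_contra hne
    exact hσ ((LiebMattis.mem_spinZSector_weight_iff 1 W φ).1 (by simpa using hφ) σ hne)
  have hpos := h0pos σ hσW
  -- `a σ = 0` would force `c = 0`, hence `a = 0`
  rcases (ha.nonneg σ).eq_or_lt with h0 | hlt
  · exfalso
    have hcσ : c * ψ₀ σ = 0 := by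
      have := congrFun hc σ
      rw [Pi.smul_apply, smul_eq_mul] at this
      rw [← this, hψ]; simp [← h0]
    have hc0 : c = 0 := by
      rcases mul_eq_zero.mp hcσ with h | h
      · exact h
      · exfalso
        have : (ψ₀ σ).re = 0 := by rw [h]; rfl
        linarith
    apply hψ0
    rw [hc, hc0, zero_smul]
  · exact hlt

/-- The `u`-representation `φ = u·ψ` of a sector vector over a Perron amplitude. [folklore] -/
theorem sector_eq_mul_perron (Δ M : ℝ) (a : TensorIndex (TorusSite 2 L) 2 → ℝ)
    (ha : IsPerronSectorGroundAmplitude L Δ M a) (φ : TensorIndex (TorusSite 2 L) 2 → ℂ)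
    (hφ : φ ∈ spinZSector (Λ := TorusSite 2 L) 1 M) (σ : TensorIndex (TorusSite 2 L) 2) :
    φ σ = (φ σ / (a σ : ℂ)) * (a σ : ℂ) := by
  by_cases h0 : φ σ = 0
  · rw [h0]; simp
  · have hpos := perronAmplitude_pos_of_ne_zero Δ M a ha φ hφ σ h0
    rw [div_mul_cancel₀ _ (by exact_mod_cast hpos.ne')]

/-! ## Linearity: the current and kinetic forms as bond sums; the shifted form -/

/-- `⟨φ, J_{η,k} v⟩ = Σ_{(x,i)} ηᵢ φ_k(x) ⟨φ, j_{x,x+eᵢ} v⟩`. [folklore] -/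
theorem currentForm_sum (k : TorusSite 2 L) (η : Fin 2 → ℂ) (φ v : TensorIndex (TorusSite 2 L) 2 → ℂ) :
    star φ ⬝ᵥ ((∑ i : Fin 2, η i • currentMode L k i) *ᵥ v)
      = ∑ p : TorusSite 2 L × Fin 2, η p.2 * torusPhase L k p.1 *
          (star φ ⬝ᵥ (bondCurrent L p.1 (p.1 + Pi.single p.2 1) *ᵥ v)) := by
  unfold currentMode
  rw [Matrix.sum_mulVec, dotProduct_sum, Fintype.sum_prod_type_right]
  refine Finset.sum_congr rfl fun i _ => ?_
  rw [Matrix.smul_mulVec, dotProduct_smul, Matrix.sum_mulVec, dotProduct_sum, smul_eq_mul, Finset.mul_sum]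
  refine Finset.sum_congr rfl fun x _ => ?_
  rw [Matrix.smul_mulVec, dotProduct_smul, smul_eq_mul]
  ring

/-- `⟨w, (−Tᵢ) v⟩ = Σ_x ⟨w, (SˣSˣ+SʸSʸ)_{x,x+eᵢ} v⟩`. [folklore] -/
theorem kineticForm_sum (i : Fin 2) (w v : TensorIndex (TorusSite 2 L) 2 → ℂ) :
    star w ⬝ᵥ (kineticOp L i *ᵥ v)
      = ∑ x : TorusSite 2 L, star w ⬝ᵥ
          ((spinBond 1 0 x (x + Pi.single i 1) + spinBond 1 1 x (x + Pi.single i 1) : Op (TorusSite 2 L) 2) *ᵥ v) := by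
  unfold kineticOp
  rw [Matrix.sum_mulVec, dotProduct_sum]

/-- `Re⟨φ, (H − E₀)φ⟩ = Re⟨φ, Hφ⟩ − E₀ Σ|φ|²`. [folklore] -/
theorem shiftedForm_re (H : Op (TorusSite 2 L) 2) (E₀ : ℝ) (φ : TensorIndex (TorusSite 2 L) 2 → ℂ) :
    (star φ ⬝ᵥ ((H - ((E₀ : ℝ) : ℂ) • (1 : Op (TorusSite 2 L) 2)) *ᵥ φ)).re
      = (star φ ⬝ᵥ (H *ᵥ φ)).re - E₀ * ∑ σ, ‖φ σ‖ ^ 2 := by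
  rw [Matrix.sub_mulVec, Matrix.smul_mulVec, Matrix.one_mulVec, dotProduct_sub, dotProduct_smul, smul_eq_mul,
    Complex.sub_re]
  congr 1
  have h : star φ ⬝ᵥ φ = ((∑ σ, ‖φ σ‖ ^ 2 : ℝ) : ℂ) := by
    rw [dotProduct, Complex.ofReal_sum]
    refine Finset.sum_congr rfl fun σ _ => ?_
    rw [Pi.star_apply, ← Complex.normSq_eq_norm_sq, Complex.normSq_eq_conj_mul_self]
    rfl
  rw [h, ← Complex.ofReal_mul, Complex.ofReal_re]

/-! ## The diamagnetic grid bound -/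

/-- **THE KEY INEQUALITY (all complex `w`):** for a Perron amplitude `ψ` (sector `M`, energy `E₀`), `φ` in the
sector, `η ∈ ℂ²`, a grid momentum `k` and `L ≥ 3`:
`0 ≤ Re⟨φ,(H−E₀)φ⟩ − 2 Re(−i w ⟨φ, J_{η,k}ψ⟩) + ½|w|² Σᵢ|ηᵢ|²⟨ψ,(−Tᵢ)ψ⟩`. [folklore] -/
theorem diamagnetic_key (hL : 3 ≤ L) (Δ M : ℝ) (a : TensorIndex (TorusSite 2 L) 2 → ℝ)
    (ha : IsPerronSectorGroundAmplitude L Δ M a) (k : TorusSite 2 L) (η : Fin 2 → ℂ)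
    (φ : TensorIndex (TorusSite 2 L) 2 → ℂ) (hφ : φ ∈ spinZSector (Λ := TorusSite 2 L) 1 M) (w : ℂ) :
    0 ≤ (star φ ⬝ᵥ ((hcbHamiltonian L Δ
            - ((lowestEnergyInSector 1 (hcbHamiltonian L Δ) M : ℝ) : ℂ) • (1 : Op (TorusSite 2 L) 2)) *ᵥ φ)).re
        - 2 * (-I * w * (star φ ⬝ᵥ ((∑ i : Fin 2, η i • currentMode L k i) *ᵥ toC L a))).re
        + (1 / 2 : ℝ) * ‖w‖ ^ 2 *
          (∑ i : Fin 2, ‖η i‖ ^ 2 * (star (toC L a) ⬝ᵥ (kineticOp L i *ᵥ toC L a)).re) := by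
  set E₀ : ℝ := lowestEnergyInSector 1 (hcbHamiltonian L Δ) M with hE₀
  set u : TensorIndex (TorusSite 2 L) 2 → ℂ := fun σ => φ σ / (a σ : ℂ) with hu
  have hφu : ∀ σ, φ σ = u σ * (a σ : ℂ) := fun σ => sector_eq_mul_perron Δ M a ha φ hφ σ
  -- (1) the quadratic form by the ground-state transform, bounded below by the directed-bond sum
  set g : Sym2 (TorusSite 2 L) → ℝ := Sym2.lift ⟨fun x y => (1 / 4 : ℝ) *
      ∑ σ : TensorIndex (TorusSite 2 L) 2, (if σ x ≠ σ y then
        a σ * a (σ ∘ Equiv.swap x y) * ‖u σ - u (σ ∘ Equiv.swap x y)‖ ^ 2 else 0),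
      fun x y => by simp only [ne_comm, Equiv.swap_comm]⟩ with hg
  have hq : (star φ ⬝ᵥ ((hcbHamiltonian L Δ - ((E₀ : ℝ) : ℂ) • (1 : Op (TorusSite 2 L) 2)) *ᵥ φ)).re
      = ∑ e ∈ (torusGraph 2 L).edgeFinset, g e := by
    rw [shiftedForm_re, hg]
    exact xxz_groundStateTransform (torusGraph 2 L) Δ a E₀ ha.eigen u φ hφu
  have hg0 : ∀ e ∈ (torusGraph 2 L).edgeFinset, 0 ≤ g e := by
    intro e _
    induction e using Sym2.ind with
    | h x y =>
      rw [hg, Sym2.lift_mk]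
      refine mul_nonneg (by norm_num) (Finset.sum_nonneg fun σ _ => ?_)
      split_ifs
      · exact mul_nonneg (mul_nonneg (ha.nonneg _) (ha.nonneg _)) (sq_nonneg _)
      · exact le_rfl
  have hQ : ∑ p : TorusSite 2 L × Fin 2, (1 / 4 : ℝ) *
        ∑ σ : TensorIndex (TorusSite 2 L) 2, (if σ p.1 ≠ σ (p.1 + Pi.single p.2 1) then
          a σ * a (σ ∘ Equiv.swap p.1 (p.1 + Pi.single p.2 1))
            * ‖u σ - u (σ ∘ Equiv.swap p.1 (p.1 + Pi.single p.2 1))‖ ^ 2 else 0)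
      ≤ (star φ ⬝ᵥ ((hcbHamiltonian L Δ - ((E₀ : ℝ) : ℂ) • (1 : Op (TorusSite 2 L) 2)) *ᵥ φ)).re := by
    rw [hq]
    have h := sum_bond_le_sum_edge hL g hg0
    simp only [hg, Sym2.lift_mk] at h
    exact h
  -- (2) the current form and (3) the kinetic form as bond sums
  have hJ : star φ ⬝ᵥ ((∑ i : Fin 2, η i • currentMode L k i) *ᵥ toC L a)
      = ∑ p : TorusSite 2 L × Fin 2, η p.2 * torusPhase L k p.1 *
          (star φ ⬝ᵥ (bondCurrent L p.1 (p.1 + Pi.single p.2 1) *ᵥ toC L a)) :=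
    currentForm_sum k η φ (toC L a)
  have hD : ∑ i : Fin 2, ‖η i‖ ^ 2 * (star (toC L a) ⬝ᵥ (kineticOp L i *ᵥ toC L a)).re
      = ∑ p : TorusSite 2 L × Fin 2, ‖η p.2 * torusPhase L k p.1‖ ^ 2 *
          (star (toC L a) ⬝ᵥ ((spinBond 1 0 p.1 (p.1 + Pi.single p.2 1)
            + spinBond 1 1 p.1 (p.1 + Pi.single p.2 1) : Op (TorusSite 2 L) 2) *ᵥ toC L a)).re := by
    rw [Fintype.sum_prod_type_right]
    refine Finset.sum_congr rfl fun i _ => ?_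
    rw [kineticForm_sum, Complex.re_sum, Finset.mul_sum]
    refine Finset.sum_congr rfl fun x _ => ?_
    rw [norm_mul, norm_torusPhase, mul_one]
  -- (4) the per-bond squares, summed
  have hbonds : 0 ≤ ∑ p : TorusSite 2 L × Fin 2,
      ((1 / 4 : ℝ) * ∑ σ : TensorIndex (TorusSite 2 L) 2, (if σ p.1 ≠ σ (p.1 + Pi.single p.2 1) then
          a σ * a (σ ∘ Equiv.swap p.1 (p.1 + Pi.single p.2 1))
            * ‖u σ - u (σ ∘ Equiv.swap p.1 (p.1 + Pi.single p.2 1))‖ ^ 2 else 0)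
        - 2 * (-I * (w * (η p.2 * torusPhase L k p.1)) *
            (star φ ⬝ᵥ (bondCurrent L p.1 (p.1 + Pi.single p.2 1) *ᵥ toC L a))).re
        + (1 / 2 : ℝ) * ‖w * (η p.2 * torusPhase L k p.1)‖ ^ 2 *
          (star (toC L a) ⬝ᵥ ((spinBond 1 0 p.1 (p.1 + Pi.single p.2 1)
            + spinBond 1 1 p.1 (p.1 + Pi.single p.2 1) : Op (TorusSite 2 L) 2) *ᵥ toC L a)).re) := by
    refine Finset.sum_nonneg fun p _ => ?_
    exact bond_square_nonneg (Ne.symm (add_single_ne_self (by omega) p.1 p.2)) a ha.nonneg u φ hφu _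
  -- (5) assemble
  rw [Finset.sum_add_distrib, Finset.sum_sub_distrib] at hbonds
  have h2 : ∑ p : TorusSite 2 L × Fin 2, 2 * (-I * (w * (η p.2 * torusPhase L k p.1)) *
        (star φ ⬝ᵥ (bondCurrent L p.1 (p.1 + Pi.single p.2 1) *ᵥ toC L a))).re
      = 2 * (-I * w * (star φ ⬝ᵥ ((∑ i : Fin 2, η i • currentMode L k i) *ᵥ toC L a))).re := by
    rw [hJ, Finset.mul_sum, Complex.re_sum, Finset.mul_sum]
    refine Finset.sum_congr rfl fun p _ => ?_
    congr 2; ring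
  have h3 : ∑ p : TorusSite 2 L × Fin 2, (1 / 2 : ℝ) * ‖w * (η p.2 * torusPhase L k p.1)‖ ^ 2 *
        (star (toC L a) ⬝ᵥ ((spinBond 1 0 p.1 (p.1 + Pi.single p.2 1)
          + spinBond 1 1 p.1 (p.1 + Pi.single p.2 1) : Op (TorusSite 2 L) 2) *ᵥ toC L a)).re
      = (1 / 2 : ℝ) * ‖w‖ ^ 2 *
        ∑ i : Fin 2, ‖η i‖ ^ 2 * (star (toC L a) ⬝ᵥ (kineticOp L i *ᵥ toC L a)).re := by
    rw [hD, Finset.mul_sum]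
    refine Finset.sum_congr rfl fun p _ => ?_
    rw [norm_mul, mul_pow]; ring
  rw [h2, h3] at hbonds
  linarith [hQ]

/-- **THE DIAMAGNETIC GRID BOUND, `L ≥ 3`** (stub (S5)(c) of THEOREM TWIST-IR, theory seat memo ROTOR-THEORY-8
§107 L3(c)/§109, corrected by the side condition `3 ≤ L`): for every Perron sector amplitude `ψ` (sector `M`,
energy `E₀`), grid momentum `k`, `η ∈ ℂ²` and `φ` in the sector,
`2 |⟨φ, (Σᵢ ηᵢ Jⁱ_k) ψ⟩|² ≤ (Σᵢ |ηᵢ|² ⟨ψ, (−Tᵢ)ψ⟩) · Re⟨φ, (H − E₀)φ⟩`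
(`m₋₁(J_{η,k}) ≤ ½ Σᵢ |ηᵢ|² ⟨−Tᵢ⟩`, the variational upper grid bound `K^{tot}(k) ≼ diag(tᵢ/2)`). [folklore] -/
theorem diamagneticGridBound_of_three_le (hL : 3 ≤ L) (Δ M : ℝ) (a : TensorIndex (TorusSite 2 L) 2 → ℝ)
    (ha : IsPerronSectorGroundAmplitude L Δ M a) (k : TorusSite 2 L) (η : Fin 2 → ℂ)
    (φ : TensorIndex (TorusSite 2 L) 2 → ℂ) (hφ : φ ∈ spinZSector (Λ := TorusSite 2 L) 1 M) :
    2 * ‖star φ ⬝ᵥ ((∑ i : Fin 2, η i • currentMode L k i) *ᵥ toC L a)‖ ^ 2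
      ≤ (∑ i : Fin 2, ‖η i‖ ^ 2 * (star (toC L a) ⬝ᵥ (kineticOp L i *ᵥ toC L a)).re)
        * (star φ ⬝ᵥ ((hcbHamiltonian L Δ
            - ((lowestEnergyInSector 1 (hcbHamiltonian L Δ) M : ℝ) : ℂ)
                • (1 : Op (TorusSite 2 L) 2)) *ᵥ φ)).re := by
  set ℓ : ℂ := star φ ⬝ᵥ ((∑ i : Fin 2, η i • currentMode L k i) *ᵥ toC L a) with hℓ
  set q : ℝ := (star φ ⬝ᵥ ((hcbHamiltonian L Δ
      - ((lowestEnergyInSector 1 (hcbHamiltonian L Δ) M : ℝ) : ℂ) • (1 : Op (TorusSite 2 L) 2)) *ᵥ φ)).re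
    with hq
  set D : ℝ := ∑ i : Fin 2, ‖η i‖ ^ 2 * (star (toC L a) ⬝ᵥ (kineticOp L i *ᵥ toC L a)).re with hD
  have key := diamagnetic_key hL Δ M a ha k η φ hφ
  -- the quadratic in `t`: `w = i t conj ℓ`
  have hquad : ∀ t : ℝ, 0 ≤ (1 / 2 : ℝ) * ‖ℓ‖ ^ 2 * D * (t * t) + (-(2 * ‖ℓ‖ ^ 2)) * t + q := by
    intro t
    have h := key (I * (t : ℂ) * conj ℓ)
    have hre : (-I * (I * (t : ℂ) * conj ℓ) * ℓ).re = t * ‖ℓ‖ ^ 2 := by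
      have e : -I * (I * (t : ℂ) * conj ℓ) * ℓ = (t : ℂ) * (conj ℓ * ℓ) := by
        rw [show -I * (I * (t : ℂ) * conj ℓ) * ℓ = -(I * I) * ((t : ℂ) * (conj ℓ * ℓ)) by ring, Complex.I_mul_I]
        ring
      rw [e, ← Complex.normSq_eq_conj_mul_self, Complex.normSq_eq_norm_sq]
      have : (t : ℂ) * ((‖ℓ‖ ^ 2 : ℝ) : ℂ) = ((t * ‖ℓ‖ ^ 2 : ℝ) : ℂ) := by push_cast; ring
      rw [this, Complex.ofReal_re]
    have hnorm : ‖I * (t : ℂ) * conj ℓ‖ ^ 2 = t ^ 2 * ‖ℓ‖ ^ 2 := by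
      rw [norm_mul, norm_mul, Complex.norm_I, one_mul, Complex.norm_real, Complex.norm_conj, mul_pow,
        Real.norm_eq_abs, sq_abs]
    rw [hre, hnorm] at h
    nlinarith [h]
  have hdisc := discrim_le_zero hquad
  rw [discrim] at hdisc
  -- `4|ℓ|⁴ − 2|ℓ|² D q ≤ 0`
  have hD0 : 0 ≤ D := by
    rw [hD]
    refine Finset.sum_nonneg fun i _ => mul_nonneg (sq_nonneg _) ?_
    rw [kineticForm_sum, Complex.re_sum]
    refine Finset.sum_nonneg fun x _ => ?_
    have hxy : x ≠ x + Pi.single i 1 := Ne.symm (add_single_ne_self (by omega) x i)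
    unfold toC
    rw [kineticBondForm_eq hxy a]
    refine Finset.sum_nonneg fun σ _ => ?_
    split_ifs
    · exact mul_nonneg (by norm_num) (mul_nonneg (ha.nonneg _) (ha.nonneg _))
    · exact le_rfl
  have hq0 : 0 ≤ q := by
    have h := key 0
    simp only [mul_zero, zero_mul, Complex.zero_re, norm_zero, sub_zero, add_zero, ne_eq,
      OfNat.ofNat_ne_zero, not_false_eq_true, zero_pow] at h
    exact h
  by_cases hℓ0 : ‖ℓ‖ = 0
  · rw [hℓ0]; simp only [ne_eq, OfNat.ofNat_ne_zero, not_false_eq_true, zero_pow, mul_zero]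
    exact mul_nonneg hD0 hq0
  · have hℓpos : 0 < ‖ℓ‖ ^ 2 := by positivity
    have h4 : ‖ℓ‖ ^ 2 * (2 * (2 * ‖ℓ‖ ^ 2 - D * q)) ≤ 0 := by nlinarith [hdisc]
    have h5 : 2 * (2 * ‖ℓ‖ ^ 2 - D * q) ≤ 0 := by
      by_contra hcon
      push Not at hcon
      have := mul_pos hℓpos hcon
      linarith
    linarith

/-- **`DiamagneticGridBound` with the side condition `3 ≤ L` (the corrected typed statement) HOLDS.** [folklore] -/
theorem diamagneticGridBoundFrom3 (Δ : ℝ) (M : ℕ → ℝ) :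
    ∀ (L : ℕ) [NeZero L], 3 ≤ L → ∀ (aM : TensorIndex (TorusSite 2 L) 2 → ℝ),
      IsPerronSectorGroundAmplitude L Δ (M L - 1) aM →
        ∀ (k : TorusSite 2 L) (η : Fin 2 → ℂ) (φ : TensorIndex (TorusSite 2 L) 2 → ℂ),
          φ ∈ spinZSector (Λ := TorusSite 2 L) 1 (M L - 1) →
            2 * ‖star φ ⬝ᵥ ((∑ i : Fin 2, η i • currentMode L k i) *ᵥ toC L aM)‖ ^ 2
              ≤ (∑ i : Fin 2, ‖η i‖ ^ 2 * (star (toC L aM) ⬝ᵥ (kineticOp L i *ᵥ toC L aM)).re)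
                * (star φ ⬝ᵥ ((hcbHamiltonian L Δ
                      - ((lowestEnergyInSector 1 (hcbHamiltonian L Δ) (M L - 1) : ℝ) : ℂ)
                          • (1 : Op (TorusSite 2 L) 2)) *ᵥ φ)).re :=
  fun L _ hL aM ha k η φ hφ => diamagneticGridBound_of_three_le hL Δ (M L - 1) aM ha k η φ hφ

end Summit.HubbardSuperconductivity.HubbardSuperconductivity.Theorems.AnisotropyChord.Stiffness
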